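import Mathlib
import Summits.ResolutionOfSingularities.ResolutionOfSingularities.Theorems.WeightedInvariantLocalWeightedDropTOT2CurveConflictConverseDivTwo
import Summits.ResolutionOfSingularities.ResolutionOfSingularities.Theorems.WeightedInvariantLocalWeightedDropTOT2CurveConflictGraphMove

/-!
# `LocalWeightedDrop`, TOT2-LINE regime (P), piece (P3) transport table — CONVERSE OF (F7): no new `u₁`-graphs at the graph-curve move

Crux item stmt-ResolutionOfSingularities-8899 `WeightedInvariant.LocalWeightedDrop` (route `ResolutionOfSingularities/WeightedInvariant`), ENGINE
skeleton v34 (80c4710965b6845c), registered stub `stub_regimePresented`, piece (P3) (res-type-088's conflict budget: CONVERSE laws of the transport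
table, S-CRV-D-DESIGN.md ADDENDUM v2.5 «remaining converses: …, graph move»; forward law (F7) = `TOT2Curve.graph_graphMove`,
…TOT2CurveConflictGraphMove p537985).  [OURS · L1 W4.3 · chain w43 · seat res-L1-w43-stub-1 gen 6; def-free; = converse of (F6) (`graph_of_divTwoT`,
…TOT2CurveConflictConverseDivTwo) + (F2) backwards + re-shear; nothing here is a statement of any manuscript; AI-produced, gate-checked, weaker than
expert review.]

* **`graph_of_graphMove`** — after the move with centre the graph curve of datum `h` (`u₂`-free) of `A` (re-centring `ψ₀`, `ψ₀(0) = 0`), i.e. on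
  `divTwoT d (shift d (shearT h A) ψ₀)`, every permissible graph curve with datum `g` comes from a permissible graph curve of `A` with datum
  `g + h`;
* `hasGraphCurveT_of_graphMove` — predicate form.
-/

set_option linter.dupNamespace false -- mandated namespace of this single-conjunct summit

noncomputable section

namespace Summit.ResolutionOfSingularities.ResolutionOfSingularities.Theorems

namespace TOT2Curve

open MvPowerSeries PolyDescent MonicDescent WildMonic Literature.AlgebraicGeometry.Resolution

variable {k : Type} [Field k] {d : ℕ}

/-- **CONVERSE OF (F7) — NO NEW `u₁`-GRAPHS AT THE GRAPH-CURVE MOVE.**  Let `h` be `u₂`-free, `ψ₀(0) = 0`, and let `V(y,u₂)` be permissible for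
the re-centred sheared label `shift d (shearT h A) ψ₀` (the centre of the move is the graph curve of datum `h`).  If the moved label
`divTwoT d (shift d (shearT h A) ψ₀)` carries a permissible graph curve with datum `g`, then `A` carries one with datum `g + h`. -/
theorem graph_of_graphMove (A : Fin d → MvPowerSeries (Fin 2) k) (h g φ' ψ₀ : MvPowerSeries (Fin 2) k)
    (hh : ∀ e : Fin 2 →₀ ℕ, e 1 ≠ 0 → coeff e h = 0) (hψ₀ : constantCoeff ψ₀ = 0) (hperm : IsPermissibleTwoT d (shift d (shearT h A) ψ₀))
    (hperm' : IsPermissibleTwoT d (shift d (shearT g (divTwoT d (shift d (shearT h A) ψ₀))) φ')) :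
    ∃ ψ : MvPowerSeries (Fin 2) k, constantCoeff ψ = 0 ∧ IsPermissibleTwoT d (shift d (shearT (g + h) A) ψ) := by
  -- converse of (F6) on the re-centred sheared label
  obtain ⟨ψ₁, hψ₁, hperm₁⟩ := graph_of_divTwoT _ hperm g φ' hperm'
  -- undo the re-centring `ψ₀` and re-shear by `h`
  have h2 := isPermissibleTwoT_graph_recentre g (shift d (shearT h A) ψ₀) ψ₁ (-ψ₀) hperm₁
  have hcomp : shearT g (shearT h A) = shearT (g + h) A := by
    funext j
    show shear g (shear h (A j)) = shear (g + h) (A j)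
    rw [shear_shear_of_noY _ _ _ hh]
  rw [PolyDescent.shift_shift_neg, hcomp] at h2
  refine ⟨ψ₁ - shear g (-ψ₀), ?_, h2⟩
  rw [map_sub, hψ₁, constantCoeff_shear_eq_zero _ _ (by rw [map_neg, hψ₀, neg_zero]), sub_zero]

/-- Predicate form: a graph curve of the moved label comes from a graph curve of `A` (datum shifted back by `h`). -/
theorem hasGraphCurveT_of_graphMove (A : Fin d → MvPowerSeries (Fin 2) k) (h ψ₀ : MvPowerSeries (Fin 2) k)
    (hh : ∀ e : Fin 2 →₀ ℕ, e 1 ≠ 0 → coeff e h = 0) (hψ₀ : constantCoeff ψ₀ = 0) (hperm : IsPermissibleTwoT d (shift d (shearT h A) ψ₀))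
    (hG : HasGraphCurveT d (divTwoT d (shift d (shearT h A) ψ₀))) : HasGraphCurveT d A := by
  obtain ⟨g, φ', hg, -, hperm'⟩ := hG
  obtain ⟨ψ, hψ, hP⟩ := graph_of_graphMove A h g φ' ψ₀ hh hψ₀ hperm hperm'
  exact ⟨g + h, ψ, fun e he => by rw [map_add, hg e he, hh e he, add_zero], hψ, hP⟩

end TOT2Curve

end Summit.ResolutionOfSingularities.ResolutionOfSingularities.Theorems

end
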